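import Mathlib
import Literature.Analysis.FluidPDE.NSBoundedMildAnalytic
import Summits.NavierStokesRegularity.NavierStokesRegularity.Theorems.TypeICertificateLadderTargetTypeIZoomPhysical
import HarnessLib

/-!
# Route `TautLoopKelvin`, crux `TautLoopLaw` (stmt-NavierStokesRegularity-15249),
  line `Sketch-ideas-r1k1` (Dini–Saks architecture) — tools stub `stub_tautLoopStepSliceAnalyticTools`

**Statement (space-analyticity of positive-time slices).** Let `ν, T > 0` and let `(u, p)` be a
classical solution of the unforced Navier–Stokes system on `[0, T) × ℝ³` which is a Leray–Hopf
solution on `[0, T)` from its rapidly decaying datum `u 0`. Then for every `0 < s < T` the slice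
`u s` and its vorticity `curl (u s)` are real-analytic on `ℝ³`.

**Proof.** (Masuda 1967 / Kahane 1969, in Lemarié-Rieusset's form, Thm. 9.12 of *The
Navier–Stokes Problem in the 21st Century* (2016).) We prove the joint real-analyticity of
`uncurry u` on the open slab `(0, T) × ℝ³` (`tautLoopAnal_analyticOnNhd_uncurry`) and read off the
slices (`analyticOnNhd_slice`, `analyticOnNhd_curl`). Near a time `t₁ ∈ (0, T)`:

1. *bounds*: `u` is bounded pointwise by some `M` on the closed slab `[0, T'] × ℝ³`,
   `T' = (t₁ + T)/2 < T` (`Target.Negative.pointwise_bounded_before`: Tao's slab bounds upgraded by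
   joint continuity);
2. *Oseen-mildness between all pairs of positive times*:
   `u t x = e^{ν(t-s)Δ} u s (x) - B^ν_s(u,u)(t)(x)` pointwise for `0 < s < t < T`
   (`typeIZoom_oseen_pairs`: duality-form mildness of Leray–Hopf solutions, restart, continuity);
3. *local analyticity of Oseen's scheme* (`lemarieRieusset2016_local_analyticity_holds`): from the
   bounded continuous datum `u s`, `s = t₁ - δ`, there is a jointly real-analytic solution `v` of
   the same integral equation on the window `(s, s + εν/M²) ∋ t₁`, bounded by `C M`;
4. *identification*: bounded solutions of the Oseen integral equation with the same free term are
   unique (`oseenMild_bounded_unique`, KNSS 2009 §4), so `u t = v t` a.e., hence everywhere (both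
   slices are continuous), for `t ∈ (s, min(s + εν/M², T'))`; thus `uncurry u = uncurry v` near
   `(t₁, x)` and `uncurry u` is analytic there.
-/

noncomputable section

open Set MeasureTheory Filter Topology Function
open Literature.Analysis Literature.Analysis.FluidPDE
open scoped ENNReal NNReal

namespace Summit.NavierStokesRegularity.NavierStokesRegularity.Theorems

set_option linter.dupNamespace false

/-- **Joint real-analyticity of the Clay class on the open slab.** For `ν, T > 0` and a classical
solution `(u, p)` on `[0, T) × ℝ³` which is Leray–Hopf on `[0, T)` from its rapidly decaying
datum, `uncurry u` is real-analytic on `(0, T) × ℝ³`: near `t₁ ∈ (0, T)` restart at `s = t₁ - δ`;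
the local real-analytic solution of Oseen's scheme from the bounded datum `u s`
(Lemarié-Rieusset 2016, Thm. 9.12, `lemarieRieusset2016_local_analyticity_holds`) coincides with
`u` on its window by the uniqueness of bounded Oseen-mild solutions (`oseenMild_bounded_unique`),
`u` being Oseen-mild between positive times (`typeIZoom_oseen_pairs`) and bounded on closed
sub-slabs (`Target.Negative.pointwise_bounded_before`). [folklore] -/
theorem tautLoopAnal_analyticOnNhd_uncurry {ν T : ℝ} (hν : 0 < ν) (hT : 0 < T)
    {u : ℝ → EuclideanSpace ℝ (Fin 3) → EuclideanSpace ℝ (Fin 3)}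
    {p : ℝ → EuclideanSpace ℝ (Fin 3) → ℝ} (hcl : IsClassicalNSSolutionOn (Ico 0 T) ν 0 u p)
    (hLH : IsLerayHopfOn T ν 0 (u 0) u) (hdec : HasRapidSpatialDecay (u 0)) :
    AnalyticOnNhd ℝ (uncurry u) (Ioo 0 T ×ˢ (univ : Set (EuclideanSpace ℝ (Fin 3)))) := by
  obtain ⟨ε, hε, CL, -, hLoc⟩ := lemarieRieusset2016_local_analyticity_holds
  have hcont : ContinuousOn (uncurry u) (Ico 0 T ×ˢ univ) := hcl.smooth_velocity.continuousOn
  have hslice : ∀ τ ∈ Ico 0 T, Continuous (u τ) := fun τ hτ =>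
    hcont.comp_continuous (Continuous.prodMk_right τ) fun x => ⟨hτ, mem_univ x⟩
  have hmild := typeIZoom_oseen_pairs ν T u p hν hT hcl hLH hdec
  intro z hz
  obtain ⟨hz1, -⟩ := mem_prod.1 hz
  -- a closed sub-slab `[0, T']` past `z.1` and a pointwise bound `M` on it
  set T' : ℝ := (z.1 + T) / 2 with hT'
  have hzT' : z.1 < T' := by rw [hT']; linarith [hz1.2]
  have hT'T : T' < T := by rw [hT']; linarith [hz1.2]
  obtain ⟨M₀, hM₀⟩ := Target.Negative.pointwise_bounded_before hν hcl hLH hdec T' hT'T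
  set M : ℝ := max M₀ 0 + 1 with hM
  have hM0 : 0 < M := by
    rw [hM]
    linarith [le_max_right M₀ 0]
  have hbdM : ∀ τ ∈ Icc 0 T', ∀ y, ‖u τ y‖ ≤ M := fun τ hτ y =>
    (hM₀ τ hτ y).trans (by rw [hM]; linarith [le_max_left M₀ 0])
  -- the window `(s, T₂) ∋ z.1`
  set h : ℝ := ε * ν / M ^ 2 with hh
  have hh0 : 0 < h := by positivity
  set δ : ℝ := min (h / 2) (z.1 / 2) with hδ
  have hδh : δ ≤ h / 2 := min_le_left _ _
  have hδz : δ ≤ z.1 / 2 := min_le_right _ _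
  have hδ0 : 0 < δ := lt_min (by linarith) (by linarith [hz1.1])
  set s : ℝ := z.1 - δ with hs
  set T₂ : ℝ := min (s + h) T' with hT₂
  have hs0 : 0 < s := by rw [hs]; linarith [hz1.1]
  have hsz : s < z.1 := by rw [hs]; linarith
  have hzT₂ : z.1 < T₂ := lt_min (by rw [hs]; linarith) hzT'
  have hT₂h : T₂ ≤ s + h := min_le_left _ _
  have hT₂T' : T₂ ≤ T' := min_le_right _ _
  have hT₂T : T₂ < T := hT₂T'.trans_lt hT'T
  -- the datum `u s`
  have hsI : s ∈ Ico 0 T := ⟨hs0.le, hsz.trans hz1.2⟩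
  have ha : AEStronglyMeasurable (u s) volume := (hslice s hsI).aestronglyMeasurable
  have haM : eLpNorm (u s) ∞ volume ≤ ENNReal.ofReal M := by
    rw [eLpNorm_exponent_top]
    exact eLpNormEssSup_le_of_ae_bound
      (Eventually.of_forall fun y => hbdM s ⟨hs0.le, (hsz.trans hzT').le⟩ y)
  obtain ⟨v, hvan, hveq, hvbd⟩ := hLoc hν s hM0 ha haM
  -- uniqueness of bounded solutions on `(s, T₂)`
  have hmax0 : 0 ≤ max M (CL * M) := hM0.le.trans (le_max_left _ _)
  have hum : AEStronglyMeasurable (uncurry u)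
      ((volume : Measure (ℝ × EuclideanSpace ℝ (Fin 3))).restrict (Ioo s T₂ ×ˢ univ)) :=
    (hcont.mono (prod_mono (fun τ hτ => ⟨hs0.le.trans hτ.1.le, hτ.2.trans hT₂T⟩)
      Subset.rfl)).aestronglyMeasurable (measurableSet_Ioo.prod MeasurableSet.univ)
  have hvm : AEStronglyMeasurable (uncurry v)
      ((volume : Measure (ℝ × EuclideanSpace ℝ (Fin 3))).restrict (Ioo s T₂ ×ˢ univ)) :=
    (hvan.continuousOn.mono (prod_mono (Ioo_subset_Ioo_right hT₂h) Subset.rfl)).aestronglyMeasurable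
      (measurableSet_Ioo.prod MeasurableSet.univ)
  have huniq : ∀ t ∈ Ioo s T₂, u t =ᵐ[volume] v t :=
    oseenMild_bounded_unique (ν := ν) (s := s) (T := T₂) (M := max M (CL * M)) (u := u) (v := v)
      (U := fun t x => UnboundedOperators.heatExtension (u s) (ν * (t - s)) x) hν hmax0 hum hvm
      (fun τ hτ y => (hbdM τ ⟨hs0.le.trans hτ.1.le, (hτ.2.trans_le hT₂T').le⟩ y).trans
        (le_max_left _ _))
      (fun τ hτ y => (hvbd τ ⟨hτ.1, hτ.2.trans_le hT₂h⟩ y).trans (le_max_right _ _))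
      (fun t ht => Eventually.of_forall (hmild s t hs0 ht.1 (ht.2.trans hT₂T)))
      (fun t ht => Eventually.of_forall fun x => hveq t ⟨ht.1, ht.2.trans_le hT₂h⟩ x)
  have hueq : ∀ t ∈ Ioo s T₂, u t = v t := by
    intro t ht
    have hcu : Continuous (u t) := hslice t ⟨hs0.le.trans ht.1.le, ht.2.trans hT₂T⟩
    have hcv : Continuous (v t) :=
      hvan.continuousOn.comp_continuous (f := fun y => (t, y)) (by fun_prop)
        fun y => mk_mem_prod ⟨ht.1, ht.2.trans_le hT₂h⟩ (mem_univ _)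
    exact (Continuous.ae_eq_iff_eq volume hcu hcv).1 (huniq t ht)
  -- analyticity at `z`
  have hzw : z ∈ Ioo s T₂ ×ˢ (univ : Set (EuclideanSpace ℝ (Fin 3))) :=
    mem_prod.2 ⟨⟨hsz, hzT₂⟩, mem_univ _⟩
  have hzv : z ∈ Ioo s (s + ε * ν / M ^ 2) ×ˢ (univ : Set (EuclideanSpace ℝ (Fin 3))) :=
    mem_prod.2 ⟨⟨hsz, hzT₂.trans_le hT₂h⟩, mem_univ _⟩
  refine (hvan z hzv).congr ?_
  filter_upwards [(isOpen_Ioo.prod isOpen_univ).mem_nhds hzw] with y hy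
  obtain ⟨hy1, -⟩ := mem_prod.1 hy
  change v y.1 y.2 = u y.1 y.2
  rw [hueq y.1 hy1]

/-- **Positive-time slices of the Clay class are real-analytic in space**, together with their
vorticity: the slice at `s ∈ (0, T)` of the jointly real-analytic field
(`tautLoopAnal_analyticOnNhd_uncurry`) is analytic (`analyticOnNhd_slice`), and the curl of an
analytic field is analytic (`analyticOnNhd_curl`). [folklore] -/
theorem tautLoopAnal_slice_and_curl {ν T : ℝ} (hν : 0 < ν) (hT : 0 < T)
    {u : ℝ → EuclideanSpace ℝ (Fin 3) → EuclideanSpace ℝ (Fin 3)}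
    {p : ℝ → EuclideanSpace ℝ (Fin 3) → ℝ} (hcl : IsClassicalNSSolutionOn (Ico 0 T) ν 0 u p)
    (hLH : IsLerayHopfOn T ν 0 (u 0) u) (hdec : HasRapidSpatialDecay (u 0)) {s : ℝ}
    (hs : 0 < s) (hsT : s < T) :
    AnalyticOnNhd ℝ (u s) univ ∧ AnalyticOnNhd ℝ (curl (u s)) univ := by
  have h := analyticOnNhd_slice (tautLoopAnal_analyticOnNhd_uncurry hν hT hcl hLH hdec) ⟨hs, hsT⟩
  exact ⟨h, analyticOnNhd_curl h⟩

/-- **Tools stub `stub_tautLoopStepSliceAnalyticTools`** (space-analyticity of positive-time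
slices): for `ν, T > 0` and a classical solution `(u, p)` of the unforced Navier–Stokes system on
`[0, T) × ℝ³` which is Leray–Hopf on `[0, T)` from its rapidly decaying datum, every slice `u s`,
`0 < s < T`, and its vorticity `curl (u s)` are real-analytic on `ℝ³` (Masuda 1967, Kahane 1969;
Lemarié-Rieusset 2016, Thm. 9.12, through `tautLoopAnal_slice_and_curl`). [folklore] -/
theorem stub_tautLoopStepSliceAnalyticTools : ∀ (ν T : ℝ), 0 < ν → 0 < T →
    ∀ (u : ℝ → EuclideanSpace ℝ (Fin 3) → EuclideanSpace ℝ (Fin 3))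
      (p : ℝ → EuclideanSpace ℝ (Fin 3) → ℝ),
    Literature.Analysis.FluidPDE.IsClassicalNSSolutionOn (Set.Ico 0 T) ν 0 u p →
    Literature.Analysis.FluidPDE.IsLerayHopfOn T ν 0 (u 0) u →
    Literature.Analysis.FluidPDE.HasRapidSpatialDecay (u 0) →
    ∀ s : ℝ, 0 < s → s < T → AnalyticOnNhd ℝ (u s) Set.univ ∧
      AnalyticOnNhd ℝ (Literature.Analysis.FluidPDE.curl (u s)) Set.univ :=
  fun _ _ hν hT _ _ hcl hLH hdec _ hs hsT => tautLoopAnal_slice_and_curl hν hT hcl hLH hdec hs hsT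

end Summit.NavierStokesRegularity.NavierStokesRegularity.Theorems

end
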